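import Literature.LinearAlgebra.TensorNetworks.JunctionTreeBounds
import Literature.Computability.Complexity.CodeFPListKit
import Literature.Computability.Complexity.CodeFPBudgets
import HarnessLib

/-!
# The junction-tree evaluation in polynomial time (typed `FP` realisation of `JT.dpValue`)

Topic `Literature/LinearAlgebra/TensorNetworks`, sequel of `JunctionTree.lean` (the functional
program `JT.dpValue O d cap par bags fs`) and `JunctionTreeBounds.lean` (the unconditional size
bound on its table entries). For a semiring `R` coded by `eR` with `+`, `·` computed on codes, factor
entries computed on codes, and a size measure `ν` controlling the code length both ways, the map
`(budget, par, bags, fs) ↦ dpValue O d |budget| par bags fs` is computed on codes in polynomial time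
(`dpValueFP`): every piece of the program is assembled from the `CodeFP` toolkit, the one loop with
a growing accumulator (the run over the bags) being a clocked iteration along a unary fuel whose
state is bounded by `JT.nu_dpFrom_le`.

Contents: accessors `bagOfFP`, `parOfFP`, `keptVarsFP`, `privVarsFP`, `homeOfFP`, `tabValFP`,
`childMsgsFP`; ring lists `listProdR`, `listSumR`; the budgeted enumeration `allAssignCapFP`;
`entryAtFP`, `mkTableFP`, the clocked run `runDPFP` and **`dpValueFP`**.

## References

* S. Arora, B. Barak, *Computational Complexity: A Modern Approach*, CUP 2009, §1.3.
* R. Dechter, Artif. Intell. 113 (1999), §§4–5.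
-/

namespace Literature.LinearAlgebra.TensorNetworks

namespace JT

open Literature.Computability.Complexity Literature.Computability.Complexity.CodeFP Polynomial
  Literature.Combinatorics.SimpleGraph.ListTD

/-! ### Accessors -/

/-- `bagOf` on codes. [cite: AroraBarak2009, §1.3] -/
theorem bagOfFP : CodeFP (pairE (rawE (rawE natE)) natE) (rawE natE) (fun p => bagOf p.1 p.2) :=
  (rawGetD (rawE natE) (d := []) rfl).congr fun _ => rfl

/-- `parOf` on codes. [cite: AroraBarak2009, §1.3] -/
theorem parOfFP : CodeFP (pairE (rawE natE) natE) natE (fun p => parOf p.1 p.2) :=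
  (rawGetD natE (d := 0) rfl).congr fun _ => rfl

/-- Membership of a numeral in a raw list, list first. [cite: AroraBarak2009, §1.3] -/
theorem memNat' : CodeFP (pairE (rawE natE) natE) bitE (fun p => decide (p.2 ∈ p.1)) :=
  (mem natE_injective).comp ((snd _ _).pair (fst _ _))

/-- `keptVars` on codes (input `((par, bags), t)`). [cite: AroraBarak2009, §1.3] -/
theorem keptVarsFP :
    CodeFP (pairE (pairE (rawE natE) (rawE (rawE natE))) natE) (rawE natE) (fun p => keptVars p.1.1 p.1.2 p.2) := by
  have ht : CodeFP (pairE (pairE (rawE natE) (rawE (rawE natE))) natE) natE (fun p => p.2) := snd _ _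
  have hbags : CodeFP (pairE (pairE (rawE natE) (rawE (rawE natE))) natE) (rawE (rawE natE)) (fun p => p.1.2) :=
    (fst _ _).snd'
  have hpar : CodeFP (pairE (pairE (rawE natE) (rawE (rawE natE))) natE) (rawE natE) (fun p => p.1.1) := (fst _ _).fst'
  have hB : CodeFP (pairE (pairE (rawE natE) (rawE (rawE natE))) natE) (rawE natE) (fun p => bagOf p.1.2 p.2) :=
    bagOfFP.comp (hbags.pair ht)
  have hP : CodeFP (pairE (pairE (rawE natE) (rawE (rawE natE))) natE) (rawE natE)
      (fun p => bagOf p.1.2 (parOf p.1.1 p.2)) := bagOfFP.comp (hbags.pair (parOfFP.comp (hpar.pair ht)))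
  have hf := filter (σ := List ℕ) (eσ := rawE natE) (eα := natE) (p := fun q => decide (q.2 ∈ q.1)) memNat'
  have hz : CodeFP (pairE (pairE (rawE natE) (rawE (rawE natE))) natE) bitE (fun p => decide (p.2 = 0)) :=
    natEq.comp (ht.pair (const _ 0))
  refine (hz.ite (const _ []) (hf.comp (hP.pair hB))).congr fun p => ?_
  by_cases h : p.2 = 0 <;> simp [keptVars, h]

/-- `privVars` on codes (input `((par, bags), t)`). [cite: AroraBarak2009, §1.3] -/
theorem privVarsFP :
    CodeFP (pairE (pairE (rawE natE) (rawE (rawE natE))) natE) (rawE natE) (fun p => privVars p.1.1 p.1.2 p.2) := by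
  have ht : CodeFP (pairE (pairE (rawE natE) (rawE (rawE natE))) natE) natE (fun p => p.2) := snd _ _
  have hbags : CodeFP (pairE (pairE (rawE natE) (rawE (rawE natE))) natE) (rawE (rawE natE)) (fun p => p.1.2) :=
    (fst _ _).snd'
  have hpar : CodeFP (pairE (pairE (rawE natE) (rawE (rawE natE))) natE) (rawE natE) (fun p => p.1.1) := (fst _ _).fst'
  have hB : CodeFP (pairE (pairE (rawE natE) (rawE (rawE natE))) natE) (rawE natE) (fun p => bagOf p.1.2 p.2) :=
    bagOfFP.comp (hbags.pair ht)
  have hB0 : CodeFP (pairE (pairE (rawE natE) (rawE (rawE natE))) natE) (rawE natE) (fun p => bagOf p.1.2 0) :=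
    bagOfFP.comp (hbags.pair (const _ 0))
  have hP : CodeFP (pairE (pairE (rawE natE) (rawE (rawE natE))) natE) (rawE natE)
      (fun p => bagOf p.1.2 (parOf p.1.1 p.2)) := bagOfFP.comp (hbags.pair (parOfFP.comp (hpar.pair ht)))
  have hf := filter (σ := List ℕ) (eσ := rawE natE) (eα := natE) (p := fun q => decide (q.2 ∉ q.1))
    (memNat'.not.congr fun q => by simp)
  have hz : CodeFP (pairE (pairE (rawE natE) (rawE (rawE natE))) natE) bitE (fun p => decide (p.2 = 0)) :=
    natEq.comp (ht.pair (const _ 0))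
  refine (hz.ite hB0 (hf.comp (hP.pair hB))).congr fun p => ?_
  by_cases h : p.2 = 0 <;> simp [privVars, h]

/-- `homeOf` on codes (input `(bags, scope)`). [cite: AroraBarak2009, §1.3] -/
theorem homeOfFP : CodeFP (pairE (rawE (rawE natE)) (rawE natE)) natE (fun p => homeOf p.1 p.2) := by
  -- the test `scope ⊆ B` with the scope as context
  have hall := all (σ := List ℕ) (eσ := rawE natE) (eα := natE) (p := fun q => decide (q.2 ∈ q.1)) memNat'
  have htest : CodeFP (pairE (rawE natE) (rawE natE)) bitE (fun q => q.1.all fun v => decide (v ∈ q.2)) :=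
    hall.comp ((snd _ _).pair (fst _ _))
  have hfind := findIdxFP (σ := List ℕ) (eσ := rawE natE) (α := List ℕ) (eα := rawE natE)
    (p := fun q => q.1.all fun v => decide (v ∈ q.2)) htest
  exact (hfind.comp ((snd _ _).pair (fst _ _))).congr fun p => rfl

variable {R : Type} [CommSemiring R] {eR : R → List Bool}

/-- `tabVal` on codes (input `(table, key)`). [cite: AroraBarak2009, §1.3] -/
theorem tabValFP (eR : R → List Bool) :
    CodeFP (pairE (rawE (pairE (rawE natE) eR)) (rawE natE)) eR (fun p => tabVal p.1 p.2) := by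
  have htest : CodeFP (pairE (rawE natE) (pairE (rawE natE) eR)) bitE (fun q => decide (q.2.1 = q.1)) :=
    (CodeFP.eq (rawE_injective natE_injective)).comp ((snd _ _).fst'.pair (fst _ _))
  have hfind := rawFind? (σ := List ℕ) (eσ := rawE natE) (α := List ℕ × R) (eα := pairE (rawE natE) eR)
    (p := fun q => decide (q.2.1 = q.1)) htest
  have hcase := optCases (σ := Unit) (eσ := unitE) (eα := pairE (rawE natE) eR) (eδ := eR)
    (k := fun _ o => match o with | some e => e.2 | none => 0) (gnone := fun _ => 0) (gsome := fun t => t.2.2)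
    (const _ 0) ((snd _ _).snd') (fun _ => rfl) (fun _ _ => rfl)
  refine ((hcase.comp ((const _ ()).pair (hfind.comp ((snd _ _).pair (fst _ _))))).congr fun p => ?_)
  obtain ⟨tab, key⟩ := p
  show (match tab.find? (fun e => decide (e.1 = key)) with | some e => e.2 | none => 0) = tabVal tab key
  rfl

omit [CommSemiring R] in
/-- `childMsgs` on codes (input `((par, t), msgs)`). [cite: AroraBarak2009, §1.3] -/
theorem childMsgsFP (eR : R → List Bool) :
    CodeFP (pairE (pairE (rawE natE) natE) (rawE (pairE natE (rawE (pairE (rawE natE) eR)))))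
      (rawE (pairE natE (rawE (pairE (rawE natE) eR)))) (fun p => childMsgs p.1.1 p.2 p.1.2) := by
  have htest : CodeFP (pairE (pairE (rawE natE) natE) (pairE natE (rawE (pairE (rawE natE) eR)))) bitE
      (fun q => decide (q.2.1 ≠ 0 ∧ parOf q.1.1 q.2.1 = q.1.2)) := by
    have h1 : CodeFP (pairE (pairE (rawE natE) natE) (pairE natE (rawE (pairE (rawE natE) eR)))) bitE
        (fun q => decide (q.2.1 = 0)) := natEq.comp ((snd _ _).fst'.pair (const _ 0))
    have h2 : CodeFP (pairE (pairE (rawE natE) natE) (pairE natE (rawE (pairE (rawE natE) eR)))) bitE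
        (fun q => decide (parOf q.1.1 q.2.1 = q.1.2)) :=
      natEq.comp ((parOfFP.comp ((fst _ _).fst'.pair (snd _ _).fst')).pair (fst _ _).snd')
    exact (h1.not.and h2).congr fun q => by
      by_cases ha : q.2.1 = 0 <;> by_cases hb : parOf q.1.1 q.2.1 = q.1.2 <;> simp [ha, hb]
  exact (filter htest).congr fun p => rfl

/-! ### Semiring elements on codes: sums and products of lists -/

/-- **A coded semiring with a size measure**: `+` and `·` computed on codes, and a size measure `ν`
(constant `K`) controlling the code length both ways with the constant `cR`
(`|eR r| ≤ cR·size(ν r) + cR` and `size(ν r) ≤ cR·|eR r| + cR`). [folklore] -/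
structure CodeRing (eR : R → List Bool) (ν : R → ℕ) (K cR : ℕ) : Prop where
  /-- the size measure -/
  size : SizeMeasure ν K
  /-- addition on codes -/
  add : CodeFP (pairE eR eR) eR fun p => p.1 + p.2
  /-- multiplication on codes -/
  mul : CodeFP (pairE eR eR) eR fun p => p.1 * p.2
  /-- short codes for small elements -/
  len_le : ∀ r, (eR r).length ≤ cR * Nat.size (ν r) + cR
  /-- small elements for short codes -/
  size_le : ∀ r, Nat.size (ν r) ≤ cR * (eR r).length + cR

variable {ν : R → ℕ} {K cR : ℕ}

/-- Size of a product of naturals. [folklore] -/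
theorem size_list_prod_le : ∀ l : List ℕ, Nat.size l.prod ≤ (l.map Nat.size).sum + 1
  | [] => by simp
  | a :: l => by
    rw [List.prod_cons, List.map_cons, List.sum_cons]
    have := size_mul_le a l.prod
    have := size_list_prod_le l
    omega

/-- The sizes of the items of a raw list total at most `cR` times its code length, twice. [folklore] -/
theorem sum_size_le (hR : CodeRing eR ν K cR) (l : List R) :
    (l.map fun a => Nat.size (ν a)).sum ≤ cR * (rawE eR l).length + cR * (rawE eR l).length := by
  induction l with
  | nil => simp
  | cons a l ih =>
    rw [List.map_cons, List.sum_cons, rawE_cons, length_boolPair]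
    have ha := hR.size_le a
    nlinarith

/-- **Products of lists of semiring elements** are computed on codes. [cite: AroraBarak2009, §1.3] -/
theorem listProdR (hR : CodeRing eR ν K cR) : CodeFP (rawE eR) eR List.prod := by
  have h := foldl₀ (eα := eR) (eβ := eR) (step := fun a acc => acc * a) (b₀ := 1)
    (hR.mul.comp ((snd _ _).pair (fst _ _)))
    (Polynomial.C (cR * (Nat.size K + 2 * cR)) * X + Polynomial.C (3 * cR + cR * 2)) (fun l₁ l₂ => by
      rw [← List.prod_eq_foldl, eval_add, eval_mul, eval_C, eval_X, eval_C]
      set L := (rawE eR (l₁ ++ l₂)).length with hL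
      have hL₁ : (rawE eR l₁).length ≤ L := length_rawE_le_of_sublist eR (List.sublist_append_left l₁ l₂)
      have hlen : l₁.length ≤ L := (length_le_length_rawE eR l₁).trans hL₁
      have h1 : ν l₁.prod ≤ K ^ l₁.length * (l₁.map ν).prod := hR.size.list_prod l₁
      have h2 : Nat.size (ν l₁.prod) ≤ l₁.length * Nat.size K + 1 + ((l₁.map fun a => Nat.size (ν a)).sum + 1) := by
        refine (size_mono h1).trans ((size_mul_le _ _).trans (Nat.add_le_add (size_pow_le _ _) ?_))
        have := size_list_prod_le (l₁.map ν)
        rw [List.map_map] at this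
        exact this
      have h3 := sum_size_le hR l₁
      have h4 := hR.len_le l₁.prod
      have h5 : l₁.length * Nat.size K ≤ L * Nat.size K := Nat.mul_le_mul_right _ hlen
      have h6 : (l₁.map fun a => Nat.size (ν a)).sum ≤ 2 * cR * L := by nlinarith
      have h7 : Nat.size (ν l₁.prod) ≤ L * (Nat.size K + 2 * cR) + 2 := by nlinarith
      calc (eR l₁.prod).length ≤ cR * Nat.size (ν l₁.prod) + cR := h4
        _ ≤ cR * (L * (Nat.size K + 2 * cR) + 2) + cR := by nlinarith
        _ = cR * (Nat.size K + 2 * cR) * L + (3 * cR + cR * 2) - 2 * cR := by ring_nf; omega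
        _ ≤ cR * (Nat.size K + 2 * cR) * L + (3 * cR + cR * 2) := Nat.sub_le _ _)
  exact h.congr fun l => (List.prod_eq_foldl (xs := l)).symm

/-- **Sums of lists of semiring elements** are computed on codes. [cite: AroraBarak2009, §1.3] -/
theorem listSumR (hR : CodeRing eR ν K cR) : CodeFP (rawE eR) eR List.sum := by
  have h := foldl₀ (eα := eR) (eβ := eR) (step := fun a acc => acc + a) (b₀ := 0)
    (hR.add.comp ((snd _ _).pair (fst _ _)))
    (Polynomial.C (cR * (cR + 1)) * X + Polynomial.C (cR * cR + cR)) (fun l₁ l₂ => by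
      rw [← List.sum_eq_foldl, eval_add, eval_mul, eval_C, eval_X, eval_C]
      set L := (rawE eR (l₁ ++ l₂)).length with hL
      have hL₁ : (rawE eR l₁).length ≤ L := length_rawE_le_of_sublist eR (List.sublist_append_left l₁ l₂)
      have hlen : l₁.length ≤ L := (length_le_length_rawE eR l₁).trans hL₁
      have h1 : ν l₁.sum ≤ (l₁.map ν).sum := hR.size.list_sum l₁
      have hitem : ∀ x ∈ l₁.map ν, Nat.size x ≤ cR * L + cR := by
        intro x hx
        obtain ⟨a, ha, rfl⟩ := List.mem_map.1 hx
        have h := hR.size_le a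
        have h' : (eR a).length ≤ L := by
          have := length_item_le_length_rawE eR ha; omega
        nlinarith
      have h2 : Nat.size (ν l₁.sum) ≤ L + (cR * L + cR) :=
        (size_mono h1).trans ((size_sum_le hitem).trans (by rw [List.length_map]; omega))
      have h4 := hR.len_le l₁.sum
      nlinarith)
  exact h.congr fun l => (List.sum_eq_foldl (xs := l)).symm

/-! ### The budgeted enumeration of value lists -/

/-- Folding a step that ignores the items iterates it. [folklore] -/
theorem foldl_const_eq_iterate {α β : Type} (F : β → β) (l : List α) (s₀ : β) :
    l.foldl (fun s _ => F s) s₀ = F^[l.length] s₀ := by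
  induction l generalizing s₀ with
  | nil => rfl
  | cons a l ih => rw [List.foldl_cons, ih, List.length_cons, Function.iterate_succ_apply]

/-- One expansion round of the enumeration: prefix every list by every value. [folklore] -/
def aaExpand (d : ℕ) (acc : List (List ℕ)) : List (List ℕ) := (List.range d).flatMap fun x => acc.map (List.cons x)

/-- `allAssign` is the iterated expansion of `[[]]`. [folklore] -/
theorem allAssign_eq_iterate (d : ℕ) : ∀ vs : List ℕ, allAssign d vs = (aaExpand d)^[vs.length] [[]]
  | [] => rfl
  | v :: vs => by rw [List.length_cons, Function.iterate_succ_apply', ← allAssign_eq_iterate d vs]; rfl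

/-- **The capped expansion round**: expand, but give up (return `[]`) beyond `cap` lists. [folklore] -/
def aaStep (d cap : ℕ) (acc : List (List ℕ)) : List (List ℕ) :=
  if (aaExpand d acc).length ≤ cap then aaExpand d acc else []

/-- Length of an expansion. [folklore] -/
theorem length_aaExpand (d : ℕ) (acc : List (List ℕ)) : (aaExpand d acc).length = d * acc.length := by
  simp [aaExpand, List.length_flatMap, List.sum_replicate, List.map_const']

/-- Within the budget the capped rounds are the true ones. [folklore] -/
theorem iterate_aaStep_eq {d cap : ℕ} (hd : 0 < d) : ∀ {n : ℕ}, d ^ n ≤ cap →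
    (aaStep d cap)^[n] [[]] = (aaExpand d)^[n] [[]]
  | 0, _ => rfl
  | n + 1, h => by
    have hn : d ^ n ≤ cap := (Nat.pow_le_pow_right hd (Nat.le_succ n)).trans h
    rw [Function.iterate_succ_apply', Function.iterate_succ_apply', iterate_aaStep_eq hd hn]
    have hlen : ((aaExpand d)^[n] [[]]).length = d ^ n := by
      rw [← List.length_replicate (n := n) (a := 0), ← allAssign_eq_iterate, length_allAssign, List.length_replicate]
    unfold aaStep
    rw [if_pos]
    rw [length_aaExpand, hlen, ← pow_succ']
    exact h

/-- **The shape of the capped iterates**: at most `max cap 1` lists, each of length `≤ n` with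
entries `< d`. [folklore] -/
theorem iterate_aaStep_shape (d cap : ℕ) : ∀ n : ℕ,
    ((aaStep d cap)^[n] [[]]).length ≤ max cap 1 ∧ ∀ l ∈ (aaStep d cap)^[n] [[]], l.length ≤ n ∧ ∀ x ∈ l, x < d
  | 0 => ⟨by simp, by simp⟩
  | n + 1 => by
    obtain ⟨-, ih⟩ := iterate_aaStep_shape d cap n
    rw [Function.iterate_succ_apply']
    set A := (aaStep d cap)^[n] [[]]
    unfold aaStep
    split_ifs with h
    · refine ⟨h.trans (le_max_left _ _), fun l hl => ?_⟩
      simp only [aaExpand, List.mem_flatMap, List.mem_range, List.mem_map] at hl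
      obtain ⟨x, hx, l', hl', rfl⟩ := hl
      obtain ⟨h1, h2⟩ := ih l' hl'
      exact ⟨by rw [List.length_cons]; omega, fun y hy => by
        rcases List.mem_cons.1 hy with rfl | hy
        · exact hx
        · exact h2 y hy⟩
    · exact ⟨by simp, by simp⟩

/-- Code length of a raw list of short raw lists of small naturals. [folklore] -/
theorem length_rawE_rawE_natE_le {A : List (List ℕ)} {n d : ℕ} (h : ∀ l ∈ A, l.length ≤ n ∧ ∀ x ∈ l, x < d) :
    (rawE (rawE natE) A).length ≤ A.length * (2 * (n * (2 * Nat.size d + 2)) + 2) := by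
  rw [length_rawE]
  calc (A.map fun l => 2 * (rawE natE l).length + 2).sum ≤ (A.map fun _ => 2 * (n * (2 * Nat.size d + 2)) + 2).sum := by
        refine List.sum_le_sum fun l hl => ?_
        obtain ⟨h1, h2⟩ := h l hl
        have h3 : (rawE natE l).length ≤ l.length * (2 * Nat.size d + 2) := by
          rw [length_rawE]
          calc (l.map fun x => 2 * (natE x).length + 2).sum ≤ (l.map fun _ => 2 * Nat.size d + 2).sum :=
                List.sum_le_sum fun x hx => by
                  rw [length_natE]; have := size_mono (h2 x hx).le; omega
            _ = l.length * (2 * Nat.size d + 2) := by rw [List.map_const', List.sum_replicate, smul_eq_mul]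
        have h4 : l.length * (2 * Nat.size d + 2) ≤ n * (2 * Nat.size d + 2) := Nat.mul_le_mul_right _ h1
        omega
    _ = A.length * (2 * (n * (2 * Nat.size d + 2)) + 2) := by rw [List.map_const', List.sum_replicate, smul_eq_mul]

/-- The expansion round on codes (`d` fixed). [cite: AroraBarak2009, §1.3] -/
theorem aaExpandFP (d : ℕ) : CodeFP (rawE (rawE natE)) (rawE (rawE natE)) (aaExpand d) := by
  -- the row of a fixed value `x`: `acc.map (cons x)`
  have hrow : CodeFP (pairE (rawE (rawE natE)) natE) (rawE (rawE natE)) (fun q => q.1.map (List.cons q.2)) := by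
    have hm := map (σ := ℕ) (eσ := natE) (eα := rawE natE) (eβ := rawE natE) (g := fun t => t.1 :: t.2)
      ((rawCons natE).comp ((fst _ _).pair (snd _ _)))
    exact (hm.comp ((snd _ _).pair (fst _ _))).congr fun q => rfl
  have hrows := map (σ := List (List ℕ)) (eσ := rawE (rawE natE)) (eα := natE) (eβ := rawE (rawE natE))
    (g := fun q => q.1.map (List.cons q.2)) hrow
  refine (((flatten (rawE natE)).comp hrows).comp ((CodeFP.id _).pair (const _ (List.range d)))).congr fun acc => ?_
  show ((List.range d).map fun x => acc.map (List.cons x)).flatten = aaExpand d acc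
  rw [aaExpand, List.flatMap_def]

/-- The capped round on codes, the budget in unary (input `(budget, acc)`). [cite: AroraBarak2009, §1.3] -/
theorem aaStepFP (d : ℕ) :
    CodeFP (pairE (rawE unitE) (rawE (rawE natE))) (rawE (rawE natE)) (fun q => aaStep d q.1.length q.2) := by
  have hexp : CodeFP (pairE (rawE unitE) (rawE (rawE natE))) (rawE (rawE natE)) (fun q => aaExpand d q.2) :=
    (aaExpandFP d).comp (snd _ _)
  have htest : CodeFP (pairE (rawE unitE) (rawE (rawE natE))) bitE
      (fun q => decide ((aaExpand d q.2).length ≤ q.1.length)) :=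
    natLe.comp (((natLength (rawE natE)).comp hexp).pair ((natLength unitE).comp (fst _ _)))
  refine (htest.ite hexp (const _ [])).congr fun q => ?_
  simp only [aaStep, decide_eq_true_eq]

/-- **The budgeted enumeration on codes** (`d ≥ 1` fixed; input `(budget, vs)`, `cap = |budget|`).
[cite: AroraBarak2009, §1.3] -/
theorem allAssignCapFP {d : ℕ} (hd : 0 < d) :
    CodeFP (pairE (rawE unitE) (rawE natE)) (rawE (rawE natE)) (fun q => allAssignCap d q.1.length q.2) := by
  -- the capped iteration along `vs`
  have hstep : CodeFP (pairE (rawE unitE) (pairE natE (rawE (rawE natE)))) (rawE (rawE natE))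
      (fun t => aaStep d t.1.length t.2.2) := (aaStepFP d).comp ((fst _ _).pair (snd _ _).snd')
  have hfold := foldl (σ := List Unit) (eσ := rawE unitE) (α := ℕ) (eα := natE) (β := List (List ℕ))
    (eβ := rawE (rawE natE)) (step := fun u _ acc => aaStep d u.length acc) (init := fun _ => [[]])
    hstep (const _ [[]]) (Polynomial.C (4 * Nat.size d + 8) * (X + 1) ^ 2) (fun u l₁ l₂ => by
      rw [foldl_const_eq_iterate]
      obtain ⟨hA, hsh⟩ := iterate_aaStep_shape d u.length l₁.length
      set L := (pairE (rawE unitE) (rawE natE) (u, l₁ ++ l₂)).length with hL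
      have hL' : L = 2 * (rawE unitE u).length + 2 + (rawE natE (l₁ ++ l₂)).length := by
        simp only [hL, pairE_apply, length_boolPair]
      have hu : u.length ≤ L := by
        have := length_le_length_rawE unitE u; omega
      have hl₁ : l₁.length ≤ L := by
        have := length_le_length_rawE natE (l₁ ++ l₂)
        rw [List.length_append] at this; omega
      refine (length_rawE_rawE_natE_le hsh).trans ?_
      rw [eval_mul, eval_C, eval_pow, eval_add, eval_X, eval_one]
      have h1 : ((aaStep d u.length)^[l₁.length] [[]]).length ≤ L + 1 := hA.trans (by omega)
      have h2 : 2 * (l₁.length * (2 * Nat.size d + 2)) + 2 ≤ (4 * Nat.size d + 8) * (L + 1) := by nlinarith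
      calc ((aaStep d u.length)^[l₁.length] [[]]).length * (2 * (l₁.length * (2 * Nat.size d + 2)) + 2)
          ≤ (L + 1) * ((4 * Nat.size d + 8) * (L + 1)) := Nat.mul_le_mul h1 h2
        _ = (4 * Nat.size d + 8) * (L + 1) ^ 2 := by ring)
  -- the budget test `d ^ |vs| ≤ cap`
  have hpow : CodeFP (rawE natE) natE (fun vs => d ^ vs.length) := by
    have h := foldl₀ (eα := natE) (eβ := natE) (step := fun _ acc => acc * d) (b₀ := 1)
      (natMul.comp ((snd _ _).pair (const _ d))) (Polynomial.C (Nat.size d) * X + 1) (fun l₁ l₂ => by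
        rw [foldl_const_eq_iterate, eval_add, eval_mul, eval_C, eval_X, eval_one, length_natE]
        have hit : ∀ n, (fun acc => acc * d)^[n] 1 = d ^ n := fun n => by
          induction n with
          | zero => rfl
          | succ n ih => rw [Function.iterate_succ_apply', ih, pow_succ]
        rw [hit]
        refine (size_pow_le d _).trans ?_
        have := length_le_length_rawE natE (l₁ ++ l₂)
        rw [List.length_append] at this
        nlinarith)
    refine h.congr fun vs => ?_
    rw [foldl_const_eq_iterate]
    induction vs.length with
    | zero => rfl
    | succ n ih => rw [Function.iterate_succ_apply', ih, pow_succ]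
  have htest : CodeFP (pairE (rawE unitE) (rawE natE)) bitE (fun q => decide (d ^ q.2.length ≤ q.1.length)) :=
    natLe.comp ((hpow.comp (snd _ _)).pair ((natLength unitE).comp (fst _ _)))
  refine (htest.ite hfold (const _ [])).congr fun q => ?_
  obtain ⟨u, vs⟩ := q
  simp only [allAssignCap, decide_eq_true_eq]
  split_ifs with h
  · rw [foldl_const_eq_iterate, iterate_aaStep_eq hd h, allAssign_eq_iterate]
  · rfl

/-! ### The product at a bag and the message of a bag -/

section Engine

variable {Φ : Type} {eΦ : Φ → List Bool} (O : FactorOps R Φ)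

/-- The code of an instance `(budget, par, bags, fs)` (`cap = |budget|`). [folklore] -/
abbrev instE (eΦ : Φ → List Bool) : List Unit × (List ℕ × (List (List ℕ) × List Φ)) → List Bool :=
  pairE (rawE unitE) (pairE (rawE natE) (pairE (rawE (rawE natE)) (rawE eΦ)))

/-- The code of a table. [folklore] -/
abbrev tabE (eR : R → List Bool) : Table R → List Bool := rawE (pairE (rawE natE) eR)

/-- The code of a message list. [folklore] -/
abbrev msgsE (eR : R → List Bool) : List (ℕ × Table R) → List Bool := rawE (pairE natE (tabE eR))

/-- The code of an association list. [folklore] -/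
abbrev assocE : List (ℕ × ℕ) → List Bool := rawE (pairE natE natE)

/-- **Factor entries on codes**: the two operations of `FactorOps` realised on codes — the scope,
and the entry at the assignment read off an association list. [folklore] -/
structure CodeFactors (O : FactorOps R Φ) (eΦ : Φ → List Bool) (eR : R → List Bool) : Prop where
  /-- the scope of a factor -/
  scope : CodeFP eΦ (rawE natE) O.scope
  /-- the entry of a factor at `assignOf A` -/
  feval : CodeFP (pairE eΦ assocE) eR fun p => O.feval p.1 (assignOf p.2)

variable {O}

/-- **`entryAt` on codes** (input `(inst, (msgs, (t, A)))`). [cite: AroraBarak2009, §1.3] -/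
theorem entryAtFP (hR : CodeRing eR ν K cR) (hO : CodeFactors O eΦ eR) :
    CodeFP (pairE (instE eΦ) (pairE (msgsE eR) (pairE natE assocE))) eR
      (fun q => entryAt O q.1.2.1 q.1.2.2.1 q.1.2.2.2 q.2.1 q.2.2.1 q.2.2.2) := by
  -- projections
  have hpar : CodeFP (pairE (instE eΦ) (pairE (msgsE eR) (pairE natE assocE))) (rawE natE) (fun q => q.1.2.1) :=
    (fst _ _).snd'.fst'
  have hbags : CodeFP (pairE (instE eΦ) (pairE (msgsE eR) (pairE natE assocE))) (rawE (rawE natE))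
      (fun q => q.1.2.2.1) := (fst _ _).snd'.snd'.fst'
  have hfs : CodeFP (pairE (instE eΦ) (pairE (msgsE eR) (pairE natE assocE))) (rawE eΦ) (fun q => q.1.2.2.2) :=
    (fst _ _).snd'.snd'.snd'
  have hmsgs : CodeFP (pairE (instE eΦ) (pairE (msgsE eR) (pairE natE assocE))) (msgsE eR) (fun q => q.2.1) :=
    (snd _ _).fst'
  have ht : CodeFP (pairE (instE eΦ) (pairE (msgsE eR) (pairE natE assocE))) natE (fun q => q.2.2.1) :=
    (snd _ _).snd'.fst'
  have hA : CodeFP (pairE (instE eΦ) (pairE (msgsE eR) (pairE natE assocE))) assocE (fun q => q.2.2.2) :=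
    (snd _ _).snd'.snd'
  -- first product: the factors housed at `t`, evaluated
  have hhome : CodeFP (pairE (pairE (rawE (rawE natE)) natE) eΦ) bitE
      (fun q => decide (homeOf q.1.1 (O.scope q.2) = q.1.2)) :=
    natEq.comp ((homeOfFP.comp ((fst _ _).fst'.pair (hO.scope.comp (snd _ _)))).pair (fst _ _).snd')
  have hfilt := filter hhome
  have hF : CodeFP (pairE (instE eΦ) (pairE (msgsE eR) (pairE natE assocE))) (rawE eΦ)
      (fun q => q.1.2.2.2.filter fun φ => decide (homeOf q.1.2.2.1 (O.scope φ) = q.2.2.1)) :=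
    (hfilt.comp ((hbags.pair ht).pair hfs)).congr fun q => rfl
  have hev := map (σ := List (ℕ × ℕ)) (eσ := assocE) (eα := eΦ) (eβ := eR) (g := fun t => O.feval t.2 (assignOf t.1))
    (hO.feval.comp ((snd _ _).pair (fst _ _)))
  have hP1 : CodeFP (pairE (instE eΦ) (pairE (msgsE eR) (pairE natE assocE))) eR
      (fun q => ((q.1.2.2.2.filter fun φ => decide (homeOf q.1.2.2.1 (O.scope φ) = q.2.2.1)).map
        fun φ => O.feval φ (assignOf q.2.2.2)).prod) :=
    ((listProdR hR).comp (hev.comp (hA.pair hF))).congr fun q => rfl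
  -- second product: the children's entries at the key values
  have hch : CodeFP (pairE (instE eΦ) (pairE (msgsE eR) (pairE natE assocE))) (msgsE eR)
      (fun q => childMsgs q.1.2.1 q.2.1 q.2.2.1) := (childMsgsFP eR).comp ((hpar.pair ht).pair hmsgs)
  -- the value of one child `m` in the context `((par, bags), A)`
  have hkeys : CodeFP (pairE (pairE (pairE (rawE natE) (rawE (rawE natE))) assocE) (pairE natE (tabE eR))) (rawE natE)
      (fun q => (keptVars q.1.1.1 q.1.1.2 q.2.1).map (assignOf q.1.2)) := by
    have hk : CodeFP (pairE (pairE (pairE (rawE natE) (rawE (rawE natE))) assocE) (pairE natE (tabE eR))) (rawE natE)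
        (fun q => keptVars q.1.1.1 q.1.1.2 q.2.1) := keptVarsFP.comp ((fst _ _).fst'.pair (snd _ _).fst')
    have hm := map (σ := List (ℕ × ℕ)) (eσ := assocE) (eα := natE) (eβ := natE) (g := fun t => assignOf t.1 t.2) assignOfFP
    exact (hm.comp ((fst _ _).snd'.pair hk)).congr fun q => rfl
  have hval : CodeFP (pairE (pairE (pairE (rawE natE) (rawE (rawE natE))) assocE) (pairE natE (tabE eR))) eR
      (fun q => tabVal q.2.2 ((keptVars q.1.1.1 q.1.1.2 q.2.1).map (assignOf q.1.2))) :=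
    (tabValFP eR).comp ((snd _ _).snd'.pair hkeys)
  have hvals := map hval
  have hP2 : CodeFP (pairE (instE eΦ) (pairE (msgsE eR) (pairE natE assocE))) eR
      (fun q => ((childMsgs q.1.2.1 q.2.1 q.2.2.1).map fun m =>
        tabVal m.2 ((keptVars q.1.2.1 q.1.2.2.1 m.1).map (assignOf q.2.2.2))).prod) :=
    ((listProdR hR).comp (hvals.comp (((hpar.pair hbags).pair hA).pair hch))).congr fun q => rfl
  exact (hR.mul.comp (hP1.pair hP2)).congr fun q => rfl

/-- **`mkTable` on codes** (input `(inst, (msgs, t))`; `d ≥ 1` fixed, `cap = |budget|`).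
[cite: AroraBarak2009, §1.3] -/
theorem mkTableFP (hR : CodeRing eR ν K cR) (hO : CodeFactors O eΦ eR) {d : ℕ} (hd : 0 < d) :
    CodeFP (pairE (instE eΦ) (pairE (msgsE eR) natE)) (tabE eR)
      (fun q => mkTable O d q.1.1.length q.1.2.1 q.1.2.2.1 q.1.2.2.2 q.2.1 q.2.2) := by
  -- projections and the pieces computed once
  have hI : CodeFP (pairE (instE eΦ) (pairE (msgsE eR) natE)) (instE eΦ) (fun q => q.1) := fst _ _
  have hu : CodeFP (pairE (instE eΦ) (pairE (msgsE eR) natE)) (rawE unitE) (fun q => q.1.1) := (fst _ _).fst'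
  have hpb : CodeFP (pairE (instE eΦ) (pairE (msgsE eR) natE)) (pairE (rawE natE) (rawE (rawE natE)))
      (fun q => (q.1.2.1, q.1.2.2.1)) := (fst _ _).snd'.fst'.pair (fst _ _).snd'.snd'.fst'
  have hmsgs : CodeFP (pairE (instE eΦ) (pairE (msgsE eR) natE)) (msgsE eR) (fun q => q.2.1) := (snd _ _).fst'
  have ht : CodeFP (pairE (instE eΦ) (pairE (msgsE eR) natE)) natE (fun q => q.2.2) := (snd _ _).snd'
  have hkept : CodeFP (pairE (instE eΦ) (pairE (msgsE eR) natE)) (rawE natE)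
      (fun q => keptVars q.1.2.1 q.1.2.2.1 q.2.2) := keptVarsFP.comp (hpb.pair ht)
  have hpriv : CodeFP (pairE (instE eΦ) (pairE (msgsE eR) natE)) (rawE natE)
      (fun q => privVars q.1.2.1 q.1.2.2.1 q.2.2) := privVarsFP.comp (hpb.pair ht)
  have hKV : CodeFP (pairE (instE eΦ) (pairE (msgsE eR) natE)) (rawE (rawE natE))
      (fun q => allAssignCap d q.1.1.length (keptVars q.1.2.1 q.1.2.2.1 q.2.2)) := (allAssignCapFP hd).comp (hu.pair hkept)
  have hPV : CodeFP (pairE (instE eΦ) (pairE (msgsE eR) natE)) (rawE (rawE natE))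
      (fun q => allAssignCap d q.1.1.length (privVars q.1.2.1 q.1.2.2.1 q.2.2)) := (allAssignCapFP hd).comp (hu.pair hpriv)
  -- context of the outer map: `c = ((inst, msgs, t), (kept, priv, PV))`
  -- context of the inner map: `(c, kv)`; item `pv`; the association list `kept.zip kv ++ priv.zip pv`
  let σ₁ := (List Unit × (List ℕ × (List (List ℕ) × List Φ))) × (List (ℕ × Table R) × ℕ)
  let eσ₁ := pairE (instE eΦ) (pairE (msgsE eR) natE)
  let σ₂ := List ℕ × (List ℕ × List (List ℕ))
  let eσ₂ := pairE (rawE natE) (pairE (rawE natE) (rawE (rawE natE)))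
  -- inner: entry at `kept.zip kv ++ priv.zip pv`
  have hinner : CodeFP (pairE (pairE (pairE eσ₁ eσ₂) (rawE natE)) (rawE natE)) eR
      (fun w => entryAt O w.1.1.1.1.2.1 w.1.1.1.1.2.2.1 w.1.1.1.1.2.2.2 w.1.1.1.2.1 w.1.1.1.2.2
        (w.1.1.2.1.zip w.1.2 ++ w.1.1.2.2.1.zip w.2)) := by
    have hA : CodeFP (pairE (pairE (pairE eσ₁ eσ₂) (rawE natE)) (rawE natE)) assocE
        (fun w => w.1.1.2.1.zip w.1.2 ++ w.1.1.2.2.1.zip w.2) :=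
      (rawAppend _).comp (((rawZip natE natE).comp ((fst _ _).fst'.snd'.fst'.pair (fst _ _).snd')).pair
        ((rawZip natE natE).comp ((fst _ _).fst'.snd'.snd'.fst'.pair (snd _ _))))
    exact (entryAtFP hR hO).comp ((fst _ _).fst'.fst'.fst'.pair
      ((fst _ _).fst'.fst'.snd'.fst'.pair ((fst _ _).fst'.fst'.snd'.snd'.pair hA)))
  have hsum : CodeFP (pairE (pairE eσ₁ eσ₂) (rawE natE)) eR
      (fun w => ((w.1.2.2.2).map fun pv => entryAt O w.1.1.1.2.1 w.1.1.1.2.2.1 w.1.1.1.2.2.2 w.1.1.2.1 w.1.1.2.2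
        (w.1.2.1.zip w.2 ++ w.1.2.2.1.zip pv)).sum) :=
    ((listSumR hR).comp ((map hinner).comp ((CodeFP.id _).pair (fst _ _).snd'.snd'.snd'))).congr fun w => rfl
  have hrow : CodeFP (pairE (pairE eσ₁ eσ₂) (rawE natE)) (pairE (rawE natE) eR)
      (fun w => (w.2, ((w.1.2.2.2).map fun pv => entryAt O w.1.1.1.2.1 w.1.1.1.2.2.1 w.1.1.1.2.2.2 w.1.1.2.1 w.1.1.2.2
        (w.1.2.1.zip w.2 ++ w.1.2.2.1.zip pv)).sum)) := (snd _ _).pair hsum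
  have houter := map hrow
  have hctx : CodeFP eσ₁ (pairE eσ₁ eσ₂) (fun q => (q, (keptVars q.1.2.1 q.1.2.2.1 q.2.2,
      (privVars q.1.2.1 q.1.2.2.1 q.2.2, allAssignCap d q.1.1.length (privVars q.1.2.1 q.1.2.2.1 q.2.2))))) :=
    (CodeFP.id _).pair (hkept.pair (hpriv.pair hPV))
  refine ((houter.comp (hctx.pair hKV)).congr fun q => ?_)
  rfl

/-! ### The clocked run -/

/-- **One clocked round of the run**: process the next bag downwards (idle at `0`). [folklore] -/
def runStep (O : FactorOps R Φ) (d cap : ℕ) (par : List ℕ) (bags : List (List ℕ)) (fs : List Φ)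
    (st : ℕ × List (ℕ × Table R)) : ℕ × List (ℕ × Table R) :=
  if st.1 = 0 then st else (st.1 - 1, stepBag O d cap par bags fs (st.1 - 1) st.2)

/-- **The clocked rounds compute `dpFrom`**: after `i` rounds from `(nb, [])` the state is
`(nb - i, dpFrom (nb - i))`. [folklore] -/
theorem iterate_runStep (d cap : ℕ) (par : List ℕ) (bags : List (List ℕ)) (fs : List Φ) : ∀ i : ℕ,
    (runStep O d cap par bags fs)^[i] (bags.length, []) =
      (bags.length - i, dpFrom O d cap par bags fs (bags.length - i))
  | 0 => by rw [Function.iterate_zero_apply, Nat.sub_zero, dpFrom_length]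
  | i + 1 => by
    rw [Function.iterate_succ_apply', iterate_runStep d cap par bags fs i]
    unfold runStep
    simp only
    by_cases h : bags.length - i = 0
    · rw [if_pos h, h, show bags.length - (i + 1) = 0 by omega]
    · rw [if_neg h, show bags.length - i - 1 = bags.length - (i + 1) by omega,
        dpFrom_of_lt O d cap par bags fs (t := bags.length - (i + 1)) (by omega),
        show bags.length - (i + 1) + 1 = bags.length - i by omega]

/-- The messages of `dpFrom t` are those of `t, …, nb - 1`, each the `mkTable` of the later ones.
[folklore] -/
theorem mem_dpFrom (d cap : ℕ) (par : List ℕ) (bags : List (List ℕ)) (fs : List Φ) : ∀ (k t : ℕ), t + k = bags.length →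
    ∀ m ∈ dpFrom O d cap par bags fs t, m.1 < bags.length ∧
      m.2 = mkTable O d cap par bags fs (dpFrom O d cap par bags fs (m.1 + 1)) m.1
  | 0, t, h => by rw [Nat.add_zero] at h; subst h; rw [dpFrom_length]; simp
  | k + 1, t, h => by
    intro m hm
    rw [dpFrom_of_lt O d cap par bags fs (by omega), stepBag, List.mem_cons] at hm
    rcases hm with rfl | hm
    · exact ⟨by simp; omega, rfl⟩
    · exact mem_dpFrom d cap par bags fs k (t + 1) (by omega) m hm

/-- The number of messages of `dpFrom t`. [folklore] -/
theorem length_dpFrom (d cap : ℕ) (par : List ℕ) (bags : List (List ℕ)) (fs : List Φ) : ∀ (k t : ℕ), t + k = bags.length →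
    (dpFrom O d cap par bags fs t).length = bags.length - t
  | 0, t, h => by rw [Nat.add_zero] at h; subst h; rw [dpFrom_length]; simp
  | k + 1, t, h => by
    rw [dpFrom_of_lt O d cap par bags fs (by omega), stepBag, List.length_cons,
      length_dpFrom d cap par bags fs k (t + 1) (by omega)]
    omega

variable {M : ℕ}

/-- **The size of the entries of `dpFrom`** (from `bInv_dpFrom` and the weight bounds; `cap` may be `0`).
[folklore] -/
theorem nu_dpFrom_le (hν : SizeMeasure ν K) {d cap : ℕ} {par : List ℕ} {bags : List (List ℕ)} {fs : List Φ}
    (hM : ∀ φ ∈ fs, ∀ a, ν (O.feval φ a) ≤ M) (hM1 : 1 ≤ M) (t : ℕ) {m : ℕ × Table R}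
    (hm : m ∈ dpFrom O d cap par bags fs t) {e : List ℕ × R} (he : e ∈ m.2) :
    ν e.2 ≤ (cap + 1) ^ bags.length * K ^ (fs.length + 2 * bags.length) * M ^ fs.length := by
  set nb := bags.length with hnb
  by_cases ht : t ≤ nb
  swap
  · have : dpFrom O d cap par bags fs t = [] := by
      rw [dpFrom, show bags.length - t = 0 by omega, List.range'_zero, List.foldr_nil]
    rw [this] at hm; simp at hm
  obtain ⟨hfst, hb⟩ := bInv_dpFrom (O := O) (d := d) (cap := cap) (par := par) (bags := bags) (fs := fs)
    hν hM (nb - t) t (by omega)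
  have hc : m.1 < nb := by
    have : m.1 ∈ (dpFrom O d cap par bags fs t).map Prod.fst := List.mem_map_of_mem hm
    rw [hfst, List.mem_range'_1] at this; omega
  refine (hb m hm e he).trans ?_
  unfold entryBound
  have hj : ∑ s ∈ Finset.Ico m.1 nb, (1 : ℕ) = nb - m.1 := by simp
  have hb' := sum_fCnt_le (O := O) (bags := bags) (fs := fs) m.1
  rw [← hnb] at hb'
  have h1 : wgt par nb (fun _ => 1) m.1 ≤ nb := (wgt_le_sum par nb _ hc).trans (by rw [hj]; omega)
  have h2 : wgt par nb (fCnt O bags fs) m.1 ≤ fs.length := (wgt_le_sum par nb _ hc).trans hb'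
  have h3 : wgt par nb (fun t => 1 + fCnt O bags fs t + (kidsIdx par nb t).card) m.1 ≤ fs.length + 2 * nb := by
    refine (wgt_le_sum par nb _ hc).trans ?_
    rw [Finset.sum_add_distrib, Finset.sum_add_distrib, hj]
    have hc' : ∑ s ∈ Finset.Ico m.1 nb, (kidsIdx par nb s).card ≤ nb :=
      (Finset.sum_le_sum_of_subset (by intro s hs; simp at hs ⊢; omega)).trans (sum_card_kidsIdx_le par nb)
    omega
  refine Nat.mul_le_mul (Nat.mul_le_mul ((Nat.pow_le_pow_left (Nat.le_succ cap) _).trans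
    (Nat.pow_le_pow_right (Nat.succ_pos cap) h1)) (Nat.pow_le_pow_right hν.one_le h3)) (Nat.pow_le_pow_right hM1 h2)

/-! ### Code length of the state of the run -/

/-- A raw list of items with short codes is short. [folklore] -/
theorem length_rawE_le_of_bound {α : Type} (e : α → List Bool) {l : List α} {B : ℕ} (h : ∀ a ∈ l, (e a).length ≤ B) :
    (rawE e l).length ≤ l.length * (2 * B + 2) := by
  rw [length_rawE]
  calc (l.map fun a => 2 * (e a).length + 2).sum ≤ (l.map fun _ => 2 * B + 2).sum :=
        List.sum_le_sum fun a ha => by have := h a ha; omega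
    _ = l.length * (2 * B + 2) := by rw [List.map_const', List.sum_replicate, smul_eq_mul]

/-- A bag is no longer than the code of the bag list. [folklore] -/
theorem length_bagOf_le (bags : List (List ℕ)) (t : ℕ) : (bagOf bags t).length ≤ (rawE (rawE natE) bags).length := by
  unfold bagOf
  rw [List.getD_eq_getElem?_getD]
  by_cases h : t < bags.length
  · rw [List.getElem?_eq_getElem h, Option.getD_some]
    have h1 := length_item_le_length_rawE (rawE natE) (List.getElem_mem h)
    have h2 := length_le_length_rawE natE bags[t]
    omega
  · rw [List.getElem?_eq_none (by omega), Option.getD_none]; exact Nat.zero_le _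

/-- **The constant of the state bound** (in the code constant `cR`, and the sizes of `K`, `M`, `d`).
[folklore] -/
def kState (cR sK sM sd : ℕ) : ℕ := 4 * (2 * (2 * sd + 2) + 2 + cR * (4 + 3 * sK + sM) + cR) + 14

/-- **The code of the state `(t, dpFrom t)` is `O(L⁴)`** in the instance length `L`.
[cite: AroraBarak2009, §1.3 (polynomially bounded intermediate results)] -/
theorem length_state_le (hR : CodeRing eR ν K cR) (hM : ∀ φ a, ν (O.feval φ a) ≤ M) (hM1 : 1 ≤ M) {d : ℕ}
    (u : List Unit) (par : List ℕ) (bags : List (List ℕ)) (fs : List Φ) {t : ℕ} (ht : t ≤ bags.length) :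
    (pairE natE (msgsE eR) (t, dpFrom O d u.length par bags fs t)).length ≤
      kState cR (Nat.size K) (Nat.size M) (Nat.size d) * ((instE eΦ (u, (par, (bags, fs)))).length + 1) ^ 4 := by
  set L := (instE eΦ (u, (par, (bags, fs)))).length with hL
  set nb := bags.length with hnb
  set cap := u.length with hcap
  set sK := Nat.size K with hsK
  set sM := Nat.size M with hsM
  set sd := Nat.size d with hsd
  have hL' : L = 2 * (rawE unitE u).length + 2 + (2 * (rawE natE par).length + 2 +
      (2 * (rawE (rawE natE) bags).length + 2 + (rawE eΦ fs).length)) := by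
    simp only [hL, instE, pairE_apply, length_boolPair]
  have hcapL : cap ≤ L := by have := length_le_length_rawE unitE u; omega
  have hnbL : nb ≤ L := by have := length_le_length_rawE (rawE natE) bags; omega
  have hfsL : fs.length ≤ L := by have := length_le_length_rawE eΦ fs; omega
  have hbagsL : (rawE (rawE natE) bags).length ≤ L := by omega
  -- powers of `L + 1` as atoms
  set P2 := (L + 1) ^ 2 with hP2
  set P3 := (L + 1) ^ 3 with hP3
  set P4 := (L + 1) ^ 4 with hP4
  have hP2L : L ≤ P2 := by rw [hP2, pow_two]; nlinarith only []
  have hLLP2 : L * (L + 1) ≤ P2 := by rw [hP2, pow_two]; exact Nat.mul_le_mul_right _ (Nat.le_succ L)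
  have hP2one : 1 ≤ P2 := by rw [hP2]; exact Nat.one_le_pow _ _ (Nat.succ_pos L)
  have hLP2 : L * P2 ≤ P3 := by
    rw [hP2, hP3, show (L + 1) ^ 3 = (L + 1) * (L + 1) ^ 2 by ring]; exact Nat.mul_le_mul_right _ (Nat.le_succ L)
  have hLP3 : L * P3 ≤ P4 := by
    rw [hP3, hP4, show (L + 1) ^ 4 = (L + 1) * (L + 1) ^ 3 by ring]; exact Nat.mul_le_mul_right _ (Nat.le_succ L)
  have hP23 : P2 ≤ P3 := le_trans (Nat.le_mul_of_pos_left _ (by omega : 0 < L + 1)) (by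
    rw [hP2, hP3, show (L + 1) ^ 3 = (L + 1) * (L + 1) ^ 2 by ring])
  have hP34 : P3 ≤ P4 := le_trans (Nat.le_mul_of_pos_left _ (by omega : 0 < L + 1)) (by
    rw [hP3, hP4, show (L + 1) ^ 4 = (L + 1) * (L + 1) ^ 3 by ring])
  have hL1P2 : L + 1 ≤ P2 := by rw [hP2, pow_two]; exact Nat.le_mul_of_pos_left _ (Nat.succ_pos L)
  have hL1P3 : L + 1 ≤ P3 := hL1P2.trans hP23
  have hL1P4 : L + 1 ≤ P4 := hL1P3.trans hP34
  -- the constants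
  set k₁ := 4 + 3 * sK + sM with hk₁
  set k₂ := 2 * (2 * sd + 2) + 2 + cR * k₁ + cR with hk₂
  -- the entries
  have hentry : ∀ m ∈ dpFrom O d cap par bags fs t, ∀ e ∈ m.2,
      (pairE (rawE natE) eR e).length ≤ k₂ * P2 := by
    intro m hm e he
    obtain ⟨hc, hm2⟩ := mem_dpFrom (O := O) d cap par bags fs (nb - t) t (by omega) m hm
    -- the value
    have hν := nu_dpFrom_le (O := O) hR.size (fun φ _ a => hM φ a) hM1 t hm he
    have hsB : Nat.size (ν e.2) ≤ k₁ * P2 := by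
      refine (size_mono hν).trans ?_
      refine (size_mul_le _ _).trans ((Nat.add_le_add ((size_mul_le _ _).trans (Nat.add_le_add (size_pow_le _ _)
        (size_pow_le _ _))) (size_pow_le _ _)).trans ?_)
      rw [← hnb, ← hsK, ← hsM]
      have h1 : Nat.size (cap + 1) ≤ L + 1 := by
        have := size_add_le cap 1
        have h' : Nat.size cap ≤ cap := by rw [← length_natE]; exact length_natE_le cap
        have h1' : Nat.size 1 = 1 := by decide
        rw [h1'] at this
        have : max (Nat.size cap) 1 ≤ cap + 1 := max_le (by omega) (by omega)
        omega
      have h2 : nb * Nat.size (cap + 1) ≤ P2 := (Nat.mul_le_mul hnbL h1).trans hLLP2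
      have h6 : (fs.length + 2 * nb) * sK ≤ 3 * P2 * sK := Nat.mul_le_mul_right _ (by omega)
      have h7 : fs.length * sM ≤ P2 * sM := Nat.mul_le_mul_right _ (hfsL.trans hP2L)
      have hk : k₁ * P2 = 4 * P2 + 3 * P2 * sK + P2 * sM := by rw [hk₁]; ring
      rw [hk]
      omega
    have hval : (eR e.2).length ≤ (cR * k₁ + cR) * P2 := by
      have h0 := hR.len_le e.2
      have h' : cR * Nat.size (ν e.2) ≤ cR * (k₁ * P2) := Nat.mul_le_mul_left _ hsB
      have h'' : cR ≤ cR * P2 := Nat.le_mul_of_pos_right _ (by omega)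
      have hk : (cR * k₁ + cR) * P2 = cR * (k₁ * P2) + cR * P2 := by ring
      rw [hk]; omega
    -- the key
    have hkey : (rawE natE e.1).length ≤ (2 * sd + 2) * P2 := by
      rw [hm2, mkTable] at he
      obtain ⟨kv, hkv, hekv⟩ := List.mem_map.1 he
      have he1 : e.1 = kv := by rw [← hekv]
      rw [he1]
      unfold allAssignCap at hkv
      split_ifs at hkv with hc'
      · obtain ⟨hlen, hlt⟩ := mem_allAssign.1 hkv
        have hB : ∀ x ∈ kv, (natE x).length ≤ sd := fun x hx => by
          rw [length_natE]; exact size_mono (hlt x hx).le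
        refine (length_rawE_le_of_bound natE hB).trans ?_
        have h1 : kv.length ≤ P2 := by
          rw [hlen]
          refine le_trans ?_ (((length_bagOf_le bags m.1).trans hbagsL).trans hP2L)
          unfold keptVars; split_ifs
          · exact Nat.zero_le _
          · exact List.length_filter_le _ _
        rw [Nat.mul_comm]
        exact Nat.mul_le_mul_left _ h1
      · simp at hkv
    have hk : k₂ * P2 = 2 * ((2 * sd + 2) * P2) + 2 * P2 + (cR * k₁ + cR) * P2 := by rw [hk₂]; ring
    simp only [pairE_apply, length_boolPair]
    rw [hk]; omega
  -- the tables
  have htab : ∀ m ∈ dpFrom O d cap par bags fs t, (pairE natE (tabE eR) m).length ≤ (2 * k₂ + 4) * P3 := by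
    intro m hm
    obtain ⟨hc, hm2⟩ := mem_dpFrom (O := O) d cap par bags fs (nb - t) t (by omega) m hm
    have hlen : m.2.length ≤ L := by
      rw [hm2, mkTable, List.length_map]; exact (length_allAssignCap_le _ _ _).trans hcapL
    have h1 := length_rawE_le_of_bound (pairE (rawE natE) eR) (hentry m hm)
    have h2 : (natE m.1).length ≤ L := (length_natE_le _).trans (by omega)
    have h3 : m.2.length * (2 * (k₂ * P2) + 2) ≤ L * (2 * (k₂ * P2) + 2) := Nat.mul_le_mul_right _ hlen
    have h4 : L * (k₂ * P2) ≤ k₂ * P3 := by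
      rw [Nat.mul_left_comm]; exact Nat.mul_le_mul_left _ hLP2
    have hk : (2 * k₂ + 4) * P3 = 2 * (k₂ * P3) + 4 * P3 := by ring
    have h5 : L * (2 * (k₂ * P2) + 2) = 2 * (L * (k₂ * P2)) + 2 * L := by ring
    simp only [pairE_apply, length_boolPair]
    rw [hk]
    rw [h5] at h3
    have : (tabE eR m.2).length ≤ 2 * (k₂ * P3) + 2 * L := h1.trans (h3.trans (by omega))
    omega
  -- the message list and the state
  have hmsgs : (msgsE eR (dpFrom O d cap par bags fs t)).length ≤ (4 * k₂ + 10) * P4 := by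
    have h1 := length_rawE_le_of_bound (pairE natE (tabE eR)) htab
    have hlen : (dpFrom O d cap par bags fs t).length ≤ L := by
      rw [length_dpFrom (O := O) d cap par bags fs (nb - t) t (by omega)]; omega
    have h3 : (dpFrom O d cap par bags fs t).length * (2 * ((2 * k₂ + 4) * P3) + 2) ≤
        L * (2 * ((2 * k₂ + 4) * P3) + 2) := Nat.mul_le_mul_right _ hlen
    have h4 : L * (k₂ * P3) ≤ k₂ * P4 := by
      rw [Nat.mul_left_comm]; exact Nat.mul_le_mul_left _ hLP3
    have h5 : L * (2 * ((2 * k₂ + 4) * P3) + 2) = 4 * (L * (k₂ * P3)) + 8 * (L * P3) + 2 * L := by ring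
    have hk : (4 * k₂ + 10) * P4 = 4 * (k₂ * P4) + 10 * P4 := by ring
    rw [hk]
    rw [h5] at h3
    exact h1.trans (h3.trans (by omega))
  have htE : (natE t).length ≤ L := (length_natE_le _).trans (ht.trans hnbL)
  simp only [pairE_apply, length_boolPair]
  have hk : kState cR sK sM sd * P4 = 4 * (k₂ * P4) + 14 * P4 := by rw [kState, hk₂, hk₁]; ring
  rw [hk]
  have hk' : (4 * k₂ + 10) * P4 = 4 * (k₂ * P4) + 10 * P4 := by ring
  rw [hk'] at hmsgs
  omega

/-- **One clocked round on codes** (input `(inst, (fuel item, state))`). [cite: AroraBarak2009, §1.3] -/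
theorem runStepFP (hR : CodeRing eR ν K cR) (hO : CodeFactors O eΦ eR) {d : ℕ} (hd : 0 < d) :
    CodeFP (pairE (instE eΦ) (pairE (rawE natE) (pairE natE (msgsE eR)))) (pairE natE (msgsE eR))
      (fun w => runStep O d w.1.1.length w.1.2.1 w.1.2.2.1 w.1.2.2.2 w.2.2) := by
  have hI : CodeFP (pairE (instE eΦ) (pairE (rawE natE) (pairE natE (msgsE eR)))) (instE eΦ) (fun w => w.1) := fst _ _
  have ht : CodeFP (pairE (instE eΦ) (pairE (rawE natE) (pairE natE (msgsE eR)))) natE (fun w => w.2.2.1) :=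
    (snd _ _).snd'.fst'
  have hmsgs : CodeFP (pairE (instE eΦ) (pairE (rawE natE) (pairE natE (msgsE eR)))) (msgsE eR) (fun w => w.2.2.2) :=
    (snd _ _).snd'.snd'
  have ht' : CodeFP (pairE (instE eΦ) (pairE (rawE natE) (pairE natE (msgsE eR)))) natE (fun w => w.2.2.1 - 1) :=
    natSub.comp (ht.pair (const _ 1))
  -- (composites with a heavy head are typed through `congr`, never by ascription: a flex-rigid
  -- unification against `mkTable …` would unfold it)
  have htab0 := (mkTableFP hR hO hd).comp (hI.pair (hmsgs.pair ht'))
  have htab : CodeFP (pairE (instE eΦ) (pairE (rawE natE) (pairE natE (msgsE eR)))) (tabE eR)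
      (fun w => mkTable O d w.1.1.length w.1.2.1 w.1.2.2.1 w.1.2.2.2 w.2.2.2 (w.2.2.1 - 1)) :=
    htab0.congr fun w => rfl
  have hnew0 := ht'.pair ((rawCons (pairE natE (tabE eR))).comp ((ht'.pair htab).pair hmsgs))
  have hz : CodeFP (pairE (instE eΦ) (pairE (rawE natE) (pairE natE (msgsE eR)))) bitE (fun w => decide (w.2.2.1 = 0)) :=
    natEq.comp (ht.pair (const _ 0))
  have hres := hz.ite (snd _ _).snd' hnew0
  refine hres.congr fun w => ?_
  obtain ⟨I, item, t, msgs⟩ := w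
  unfold runStep
  by_cases h : t = 0
  · simp only [h]; rfl
  · simp only [h, decide_false]; rfl

/-- **The run on codes** (input `inst = (budget, par, bags, fs)`): the clocked iteration of
`runStep` along the bag list as fuel, its state bounded by `length_state_le`.
[cite: AroraBarak2009, §1.3] -/
theorem runDPFP (hR : CodeRing eR ν K cR) (hO : CodeFactors O eΦ eR) (hM : ∀ φ a, ν (O.feval φ a) ≤ M) (hM1 : 1 ≤ M)
    {d : ℕ} (hd : 0 < d) :
    CodeFP (instE eΦ) (msgsE eR) (fun I => runDP O d I.1.length I.2.1 I.2.2.1 I.2.2.2) := by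
  have hinit : CodeFP (instE eΦ) (pairE natE (msgsE eR)) (fun I => (I.2.2.1.length, ([] : List (ℕ × Table R)))) :=
    ((natLength (rawE natE)).comp (snd _ _).snd'.fst').pair (const _ [])
  have hfold := foldl (σ := List Unit × (List ℕ × (List (List ℕ) × List Φ))) (eσ := instE eΦ) (α := List ℕ)
    (eα := rawE natE) (β := ℕ × List (ℕ × Table R)) (eβ := pairE natE (msgsE eR))
    (step := fun I _ st => runStep O d I.1.length I.2.1 I.2.2.1 I.2.2.2 st)
    (init := fun I => (I.2.2.1.length, ([] : List (ℕ × Table R)))) (runStepFP hR hO hd) hinit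
    (Polynomial.C (kState cR (Nat.size K) (Nat.size M) (Nat.size d)) * (X + 1) ^ 4) (fun I l₁ l₂ => by
      obtain ⟨u, par, bags, fs⟩ := I
      rw [foldl_const_eq_iterate, iterate_runStep, eval_mul, eval_C, eval_pow, eval_add, eval_X, eval_one]
      refine (length_state_le (eΦ := eΦ) (d := d) hR hM hM1 u par bags fs (Nat.sub_le _ _)).trans
        (Nat.mul_le_mul_left _ (Nat.pow_le_pow_left (Nat.succ_le_succ ?_) 4))
      simp only [pairE_apply, length_boolPair]
      omega)
  refine (((snd natE (msgsE eR)).comp hfold).comp ((CodeFP.id _).pair (snd _ _).snd'.fst')).congr fun I => ?_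
  obtain ⟨u, par, bags, fs⟩ := I
  show ((bags.foldl (fun st _ => runStep O d u.length par bags fs st) (bags.length, [])).2) = runDP O d u.length par bags fs
  rw [foldl_const_eq_iterate, iterate_runStep, Nat.sub_self, runDP_eq_dpFrom]

/-- **The junction-tree value on codes**: `(budget, par, bags, fs) ↦ dpValue O d |budget| par bags fs`
is computed in polynomial time. [cite: AroraBarak2009, §1.3] [cite: Dechter1999, §§4–5] -/
theorem dpValueFP (hR : CodeRing eR ν K cR) (hO : CodeFactors O eΦ eR) (hM : ∀ φ a, ν (O.feval φ a) ≤ M) (hM1 : 1 ≤ M)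
    {d : ℕ} (hd : 0 < d) :
    CodeFP (instE eΦ) eR (fun I => dpValue O d I.1.length I.2.1 I.2.2.1 I.2.2.2) := by
  have hrun := runDPFP hR hO hM hM1 hd
  have hcase := rawCases (σ := Unit) (eσ := unitE) (eα := pairE natE (tabE eR)) (eδ := eR)
    (k := fun _ l => match l with | [] => (0 : R) | m :: _ => tabVal m.2 [])
    (gnil := fun _ => 0) (gcons := fun t => tabVal t.2.1.2 []) (const _ 0)
    ((tabValFP eR).comp ((snd _ _).fst'.snd'.pair (const _ []))) (fun _ => rfl) (fun _ _ _ => rfl)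
  refine ((hcase.comp ((const _ ()).pair hrun)).congr fun I => ?_)
  simp only [dpValue]
  rcases runDP O d I.1.length I.2.1 I.2.2.1 I.2.2.2 with _ | ⟨m, _⟩ <;> rfl

end Engine

end JT

end Literature.LinearAlgebra.TensorNetworks
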